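import Literature.Algebra.EuclideanLattices.RegevQuantumPartStates
import HarnessLib

/-!
# Regev 2009, Lemma 3.14 (machine form): the Gaussian mass of the points with long lattice part

Topic `Algebra/EuclideanLattices` (family `pqc`), grouping namespace `Regev2009.QPart`; sequel of
`RegevQuantumPartFibres.lean` (`sum_normSq_bad_le`: the BAD points carry at most the tails `Σ τ²`) and
`RegevQuantumPartStates.lean` (`l2Norm_phiState_sub_phiIdeal_le_of_small`: `Z ≤ Z′ ≤ 2Z` under the
smallness hypothesis `e^{2πBY} 2⁻ⁿ ≤ Cκ`). When the `CVP_{L*}` oracle of Regev's sampler (J. ACM 56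
(2009), art. 34, Lemma 3.14 as used in the proof of Lemma 3.3) is replaced by the `CVP` PROCEDURE, the
procedure is only guaranteed on queries whose point lies within the admissibility radius of `L*` — in
the rescaled units of this series, on the points `x` whose lattice part `x − y(x)` is SHORT
(`‖x − y(x)‖ < √n`). The remaining points are charged to the Gaussian tail, which this file bounds:

* `sum_normSq_long_le` — `Σ_{x ∈ Box, ‖x − y(x)‖ ≥ √n} ρ(x)² ≤ Σ_{y,s} τ_y(s)²` (the long points of each
  fibre, squared inside the fibre; same bookkeeping as `sum_normSq_bad_le`, for ALL long points);
* `sum_tailBranchAmp_sq_le_of_small` — `Σ_{y,s} τ_y(s)² ≤ (2 C Z)²` under the smallness hypothesis;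
* **`sum_normSq_long_le_of_small`** — `Σ_{long} ρ(x)² ≤ (2C)² Z²`, and the normalised form
  **`sum_boxWeight_long_le`** — `Σ_{long} (ρ(x)/Z)² ≤ (2C)²`; `sum_boxWeight_eq_one` — the weights
  `(ρ(x)/Z)²` sum to `1` (they are the law of the measured point, `Cryptography/RegevCVPOracleWeighted`).

Everything is proved; no definition, no named fact is introduced.

## References

* O. Regev, *On lattices, learning with errors, random linear codes, and cryptography*, J. ACM 56
  (2009), art. 34; author's version arXiv:2401.03703: Claim 3.13, Lemma 3.14 (proof, p. 20), Lemma 3.3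
  (proof, p. 15) [Regev2009].
* W. Banaszczyk, *New bounds in some transference theorems in the geometry of numbers*, Math. Ann. 296
  (1993) 625–635, Lemma 1.5 [Banaszczyk1993].
-/

noncomputable section

open Module Metric Complex Finset
open scoped Real InnerProductSpace ENNReal

namespace Literature.Algebra.EuclideanLattices

namespace Regev2009

namespace QPart

open Literature.Computability.QuantumComplexity Literature.Computability.QuantumComplexity.QState

variable {V : Type*} [NormedAddCommGroup V] [InnerProductSpace ℝ V]
variable {ι : Type*} [Fintype ι]
variable {Λ : Submodule ℤ V} {e : Basis ι ℤ Λ} {R : ℕ}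
variable {Box : Finset V} {yOf : V → V} {sOf : V → ι → ZMod R} {Good : V → Prop}

/-! ### The long points carry at most the tails -/

open Classical in
/-- **The points with long lattice part carry at most the tails**:
`Σ_{x ∈ Box, √n ≤ ‖x − y(x)‖} ρ(x)² ≤ Σ_{y ∈ y(Box)} Σ_s τ_y(s)²`. [cite: Regev2009, Lemma 3.14 (proof), Claim 3.13] -/
theorem sum_normSq_long_le [DecidableEq ι] [NeZero R] [DecidableEq V] (hH : FibreHyps Λ e R Box yOf sOf Good) :
    ∑ x ∈ Box.filter (fun x => Real.sqrt (finrank ℝ V) ≤ ‖x - yOf x‖), gaussianFunction 1 x ^ 2 ≤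
      ∑ y ∈ Box.image yOf, ∑ s : ι → ZMod R, tailBranchAmp Λ e R Box y s ^ 2 := by
  classical
  -- regroup the long points by their fibre
  have hmaps : ∀ x ∈ Box.filter (fun x => Real.sqrt (finrank ℝ V) ≤ ‖x - yOf x‖),
      (yOf x, sOf x) ∈ (Box.image yOf) ×ˢ (univ : Finset (ι → ZMod R)) :=
    fun x hx => mem_product.2 ⟨mem_image_of_mem _ (mem_filter.1 hx).1, mem_univ _⟩
  rw [← sum_fiberwise_of_maps_to hmaps, sum_product]
  refine sum_le_sum fun y hy => sum_le_sum fun s _ => ?_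
  obtain ⟨x₀, hx₀, rfl⟩ := mem_image.1 hy
  calc ∑ x ∈ (Box.filter (fun x => Real.sqrt (finrank ℝ V) ≤ ‖x - yOf x‖)).filter
          (fun x => (yOf x, sOf x) = (yOf x₀, s)), gaussianFunction 1 x ^ 2
      ≤ (∑ x ∈ (Box.filter (fun x => Real.sqrt (finrank ℝ V) ≤ ‖x - yOf x‖)).filter
          (fun x => (yOf x, sOf x) = (yOf x₀, s)), gaussianFunction 1 x) ^ 2 :=
        sum_sq_le_sq_sum_of_nonneg fun _ _ => (gaussianFunction_pos _ _).le
    _ ≤ tailBranchAmp Λ e R Box (yOf x₀) s ^ 2 := by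
        refine pow_le_pow_left₀ (sum_nonneg fun _ _ => (gaussianFunction_pos _ _).le) ?_ 2
        unfold tailBranchAmp
        refine sum_le_sum_of_subset_of_nonneg (fun x hx => ?_) (fun _ _ _ => (gaussianFunction_pos _ _).le)
        simp only [mem_filter, Prod.mk.injEq] at hx
        obtain ⟨⟨hxB, hlong⟩, hy, hs⟩ := hx
        have hfib : x ∈ fibre Λ e R Box (yOf x₀) s := by
          rw [← filter_yOf_sOf_eq_fibre hH hx₀ s]
          exact mem_filter.2 ⟨hxB, hy, hs⟩
        unfold fibre at hfib
        rw [mem_filter] at hfib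
        rw [hy] at hlong
        exact mem_filter.2 ⟨hxB, hfib.2, hlong⟩

/-! ### Under the smallness hypothesis -/

/-- **`Σ_{y,s} τ_y(s)² ≤ (2CZ)²`** under the smallness hypothesis `e^{2πBY} 2⁻ⁿ ≤ Cκ`, `C ≤ 1/2`
(`κ² Σ τ² ≤ e^{4πBY} 4⁻ⁿ Σ ψ²` and `√(Σ ψ²) ≤ 2Z`). [cite: Regev2009, Claim 3.13, Lemma 3.14 (proof)] [cite: Banaszczyk1993, Lemma 1.5] -/
theorem sum_tailBranchAmp_sq_le_of_small [FiniteDimensional ℝ V] [MeasurableSpace V] [BorelSpace V]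
    [DiscreteTopology Λ] [IsZLattice ℝ Λ] [DecidableEq V] [DecidablePred Good] {m κ W : ℕ} {e : Basis (Fin m) ℤ Λ}
    [NeZero (2 ^ κ : ℕ)] {sOf : V → Fin m → ZMod (2 ^ κ)}
    {S : Fin m → (Fin κ ↪ Fin W)} {base : V → Literature.Computability.Cryptography.QReg W}
    {enc : ZMod (2 ^ κ) → Fin κ → Bool} {lab₀ : V → Literature.Computability.Cryptography.QReg W}
    {κc : Literature.Computability.Cryptography.QReg W → Literature.Computability.Cryptography.QReg W} {B Y C : ℝ}
    (hH : FibreHyps Λ e (2 ^ κ) Box yOf sOf Good) (hR : RegHyps S base enc Box yOf sOf Good lab₀ κc) (hne : Box.Nonempty)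
    (hsvΛ : ∀ z ∈ scaledLattice Λ (2 ^ κ), ‖z‖ < 2 * Real.sqrt (finrank ℝ V) → z = 0)
    (hBox : ∀ x ∈ Box, BoxCoversShort Λ Box (yOf x)) (hY : ∀ x ∈ Box, ‖yOf x‖ ≤ Y)
    (hB : ∀ x ∈ Box, ∀ x' ∈ Box, ‖x - yOf x'‖ ≤ B)
    (hδ : π * (2 * Real.sqrt (finrank ℝ V) * Y + Y ^ 2) < 1)
    (hC : Real.exp (2 * π * B * Y) * (2⁻¹ : ℝ) ^ finrank ℝ V ≤
      C * ((1 - π * (2 * Real.sqrt (finrank ℝ V) * Y + Y ^ 2)) * (1 - banaConst ^ finrank ℝ V) * (1 - (4⁻¹ : ℝ) ^ finrank ℝ V)))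
    (hC2 : C ≤ 1 / 2) (hC0 : 0 ≤ C) :
    ∑ y ∈ Box.image yOf, ∑ s : Fin m → ZMod (2 ^ κ), tailBranchAmp Λ e (2 ^ κ) Box y s ^ 2 ≤ (2 * C * zBox Box) ^ 2 := by
  classical
  set n := finrank ℝ V with hn
  set κ₀ : ℝ := (1 - π * (2 * Real.sqrt n * Y + Y ^ 2)) * (1 - banaConst ^ n) * (1 - (4⁻¹ : ℝ) ^ n) with hκ₀
  set TT : ℝ := ∑ y ∈ Box.image yOf, ∑ s : Fin m → ZMod (2 ^ κ), tailBranchAmp Λ e (2 ^ κ) Box y s ^ 2 with hTT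
  set ZP2 : ℝ := ∑ y ∈ Box.image yOf, ∑ s : Fin m → ZMod (2 ^ κ), branchAmp Λ e (2 ^ κ) Box y s ^ 2 with hZP2
  have hκ₀pos : 0 < κ₀ := by
    by_contra hle
    push Not at hle
    have h3 : 0 < Real.exp (2 * π * B * Y) * (2⁻¹ : ℝ) ^ n := by positivity
    have h4 : C * κ₀ ≤ 0 := mul_nonpos_of_nonneg_of_nonpos hC0 hle
    linarith
  have hZP2nn : 0 ≤ ZP2 := sum_nonneg fun _ _ => sum_nonneg fun _ _ => sq_nonneg _
  -- `κ₀² TT ≤ e^{4πBY} 4⁻ⁿ ZP2 ≤ (C κ₀)² ZP2`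
  have htail := sum_tail_sq_le (e := e) hsvΛ hBox hY hB hδ
  rw [← hκ₀, ← hTT, ← hZP2] at htail
  have hE : Real.exp (4 * π * B * Y) * (4⁻¹ : ℝ) ^ n = (Real.exp (2 * π * B * Y) * (2⁻¹ : ℝ) ^ n) ^ 2 := by
    rw [mul_pow, ← Real.exp_nat_mul, ← pow_mul]; congr 1; · push_cast; ring_nf
    · rw [show (2⁻¹ : ℝ) ^ (n * 2) = ((2⁻¹ : ℝ) ^ 2) ^ n by rw [mul_comm, pow_mul]]; norm_num
  rw [hE] at htail
  have h3 : (Real.exp (2 * π * B * Y) * (2⁻¹ : ℝ) ^ n) ^ 2 ≤ (C * κ₀) ^ 2 := pow_le_pow_left₀ (by positivity) hC 2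
  have h5 : κ₀ ^ 2 * TT ≤ κ₀ ^ 2 * (C ^ 2 * ZP2) :=
    calc κ₀ ^ 2 * TT ≤ (C * κ₀) ^ 2 * ZP2 := htail.trans (mul_le_mul_of_nonneg_right h3 hZP2nn)
      _ = κ₀ ^ 2 * (C ^ 2 * ZP2) := by ring
  have hTTle : TT ≤ C ^ 2 * ZP2 := le_of_mul_le_mul_left h5 (pow_pos hκ₀pos 2)
  -- `√ZP2 ≤ 2Z`
  have hZ' := (l2Norm_phiState_sub_phiIdeal_le_of_small hH hR hne hsvΛ hBox hY hB hδ hC hC2 hC0).2.2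
  rw [← hZP2] at hZ'
  have hZP2le : ZP2 ≤ (2 * zBox Box) ^ 2 := by
    calc ZP2 = Real.sqrt ZP2 ^ 2 := (Real.sq_sqrt hZP2nn).symm
      _ ≤ (2 * zBox Box) ^ 2 := pow_le_pow_left₀ (Real.sqrt_nonneg _) hZ' 2
  calc TT ≤ C ^ 2 * ZP2 := hTTle
    _ ≤ C ^ 2 * (2 * zBox Box) ^ 2 := mul_le_mul_of_nonneg_left hZP2le (sq_nonneg _)
    _ = (2 * C * zBox Box) ^ 2 := by ring

/-- **The long points carry at most `(2C)² Z²`.** [cite: Regev2009, Claim 3.13, Lemma 3.14 (proof)] [cite: Banaszczyk1993, Lemma 1.5] -/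
theorem sum_normSq_long_le_of_small [FiniteDimensional ℝ V] [MeasurableSpace V] [BorelSpace V]
    [DiscreteTopology Λ] [IsZLattice ℝ Λ] [DecidableEq V] [DecidablePred Good] {m κ W : ℕ} {e : Basis (Fin m) ℤ Λ}
    [NeZero (2 ^ κ : ℕ)] {sOf : V → Fin m → ZMod (2 ^ κ)}
    {S : Fin m → (Fin κ ↪ Fin W)} {base : V → Literature.Computability.Cryptography.QReg W}
    {enc : ZMod (2 ^ κ) → Fin κ → Bool} {lab₀ : V → Literature.Computability.Cryptography.QReg W}
    {κc : Literature.Computability.Cryptography.QReg W → Literature.Computability.Cryptography.QReg W} {B Y C : ℝ}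
    (hH : FibreHyps Λ e (2 ^ κ) Box yOf sOf Good) (hR : RegHyps S base enc Box yOf sOf Good lab₀ κc) (hne : Box.Nonempty)
    (hsvΛ : ∀ z ∈ scaledLattice Λ (2 ^ κ), ‖z‖ < 2 * Real.sqrt (finrank ℝ V) → z = 0)
    (hBox : ∀ x ∈ Box, BoxCoversShort Λ Box (yOf x)) (hY : ∀ x ∈ Box, ‖yOf x‖ ≤ Y)
    (hB : ∀ x ∈ Box, ∀ x' ∈ Box, ‖x - yOf x'‖ ≤ B)
    (hδ : π * (2 * Real.sqrt (finrank ℝ V) * Y + Y ^ 2) < 1)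
    (hC : Real.exp (2 * π * B * Y) * (2⁻¹ : ℝ) ^ finrank ℝ V ≤
      C * ((1 - π * (2 * Real.sqrt (finrank ℝ V) * Y + Y ^ 2)) * (1 - banaConst ^ finrank ℝ V) * (1 - (4⁻¹ : ℝ) ^ finrank ℝ V)))
    (hC2 : C ≤ 1 / 2) (hC0 : 0 ≤ C) :
    ∑ x ∈ Box.filter (fun x => Real.sqrt (finrank ℝ V) ≤ ‖x - yOf x‖), gaussianFunction 1 x ^ 2 ≤
      (2 * C) ^ 2 * zBox Box ^ 2 := by
  classical
  calc ∑ x ∈ Box.filter (fun x => Real.sqrt (finrank ℝ V) ≤ ‖x - yOf x‖), gaussianFunction 1 x ^ 2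
      ≤ ∑ y ∈ Box.image yOf, ∑ s : Fin m → ZMod (2 ^ κ), tailBranchAmp Λ e (2 ^ κ) Box y s ^ 2 := sum_normSq_long_le hH
    _ ≤ (2 * C * zBox Box) ^ 2 := sum_tailBranchAmp_sq_le_of_small hH hR hne hsvΛ hBox hY hB hδ hC hC2 hC0
    _ = (2 * C) ^ 2 * zBox Box ^ 2 := by ring

/-! ### The normalised weights -/

omit [InnerProductSpace ℝ V] [Fintype ι] in
/-- **The Gaussian weights of the box sum to one**: `Σ_{x ∈ Box} (ρ(x)/Z)² = 1` (nonempty box).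
[cite: Regev2009, Lemma 3.14 (proof)] -/
theorem sum_boxWeight_eq_one (hne : Box.Nonempty) : ∑ x ∈ Box, (gaussianFunction 1 x / zBox Box) ^ 2 = 1 := by
  have hZ := zBox_pos hne
  simp_rw [div_pow]
  rw [← sum_div, ← zBox_sq, div_self (pow_ne_zero 2 hZ.ne')]

/-- **The long points have Gaussian weight at most `(2C)²`**: `Σ_{x ∈ Box, √n ≤ ‖x − y(x)‖} (ρ(x)/Z)² ≤ (2C)²`.
[cite: Regev2009, Claim 3.13, Lemma 3.14 (proof), Lemma 3.3 (proof)] [cite: Banaszczyk1993, Lemma 1.5] -/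
theorem sum_boxWeight_long_le [FiniteDimensional ℝ V] [MeasurableSpace V] [BorelSpace V]
    [DiscreteTopology Λ] [IsZLattice ℝ Λ] [DecidableEq V] [DecidablePred Good] {m κ W : ℕ} {e : Basis (Fin m) ℤ Λ}
    [NeZero (2 ^ κ : ℕ)] {sOf : V → Fin m → ZMod (2 ^ κ)}
    {S : Fin m → (Fin κ ↪ Fin W)} {base : V → Literature.Computability.Cryptography.QReg W}
    {enc : ZMod (2 ^ κ) → Fin κ → Bool} {lab₀ : V → Literature.Computability.Cryptography.QReg W}
    {κc : Literature.Computability.Cryptography.QReg W → Literature.Computability.Cryptography.QReg W} {B Y C : ℝ}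
    (hH : FibreHyps Λ e (2 ^ κ) Box yOf sOf Good) (hR : RegHyps S base enc Box yOf sOf Good lab₀ κc) (hne : Box.Nonempty)
    (hsvΛ : ∀ z ∈ scaledLattice Λ (2 ^ κ), ‖z‖ < 2 * Real.sqrt (finrank ℝ V) → z = 0)
    (hBox : ∀ x ∈ Box, BoxCoversShort Λ Box (yOf x)) (hY : ∀ x ∈ Box, ‖yOf x‖ ≤ Y)
    (hB : ∀ x ∈ Box, ∀ x' ∈ Box, ‖x - yOf x'‖ ≤ B)
    (hδ : π * (2 * Real.sqrt (finrank ℝ V) * Y + Y ^ 2) < 1)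
    (hC : Real.exp (2 * π * B * Y) * (2⁻¹ : ℝ) ^ finrank ℝ V ≤
      C * ((1 - π * (2 * Real.sqrt (finrank ℝ V) * Y + Y ^ 2)) * (1 - banaConst ^ finrank ℝ V) * (1 - (4⁻¹ : ℝ) ^ finrank ℝ V)))
    (hC2 : C ≤ 1 / 2) (hC0 : 0 ≤ C) :
    ∑ x ∈ Box.filter (fun x => Real.sqrt (finrank ℝ V) ≤ ‖x - yOf x‖), (gaussianFunction 1 x / zBox Box) ^ 2 ≤ (2 * C) ^ 2 := by
  classical
  have hZ := zBox_pos hne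
  simp_rw [div_pow]
  rw [← sum_div, div_le_iff₀ (pow_pos hZ 2)]
  exact sum_normSq_long_le_of_small hH hR hne hsvΛ hBox hY hB hδ hC hC2 hC0

end QPart

end Regev2009

end Literature.Algebra.EuclideanLattices

end
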